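import Literature.AlgebraicGeometry.HodgeTheory.GlIdentityComponentInvariantSplitting
import HarnessLib

/-!
# Route `Q8SymplecticPowers`, crux K1Q «mechanism-v2» — glue S7(c), part 1: the finite-orbit part `N` is the fixed space of ONE
# finite-index (normal) subgroup; restriction groups; stability of `N`, `N^⊥`, eigenspaces

Support file for crux K1Q (stmt-HodgeConjecture-24190; `--supports … --as helper`; nothing here closes an item). Prover seat
`hodge-nonav-19716-p2` (g14), owner of stub S7 `stub_transportHeredityQ` of the registered skeleton «mechanism-v2» (p3 g36, sha
fc50b995…). Referee audit #36 (a) made the following DISPLAY OBLIGATIONS of S7 explicit; they are pure group ∕ linear algebra over any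
field `K` on a finite-dimensional `H` with `Γ ≤ GL_K(H)`:

* `exists_finiteIndex_normal_span_fixed_iff` — with `N := span {x | some finite-index Γ' ≤ Γ fixes x}` (the registered `N` of S4∕S5∕S7):
  there is ONE `Γ₀ ≤ Γ` of finite index, normal in `Γ`, with `N = Fix(Γ₀)` («maximality ∕ noetherianity of the directed union»: a finite
  spanning subset of the generators, the finite intersection of their stabilisers, its normal core).
* `span_fixed_map_mem` — `N` is `Γ`-stable; `span_fixed_map_mem_of_comm` — and stable under every endomorphism commuting with `Γ`.
* `exists_restrictSubgroup`, `le_and_finiteIndex_restrictSubgroup` — for `W ≤ H` stable under `Γ`, the group `Γ_W ≤ GL_K(W)` of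
  restrictions EXISTS in the interface of `GlIdentityComponentInvariantSplitting` (`η ∈ Γ_W ↔ ∃ θ ∈ Γ, η = θ|_W`), and a finite-index
  `Γ₀ ≤ Γ` restricts to a finite-index `Γ₀_W ≤ Γ_W`.
* `orthogonal_map_mem_of_isometry`, `apply_mem_eigenspace_of_comm` — an isometry whose inverse preserves `N` preserves `Q.orthogonal N`;
  a map commuting with `f` preserves the eigenspaces of `f`.

Part 2 (separate file, importing prover-Ax's `Q8BireflectionGroupDensityAmbient`) assembles the RESTRICTION CURRENCY of S7(c).
HONEST FRAMING: algebra only; K1Q ∕ HC ∕ HC_AV NOT proved; item 24190 OPEN.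

## References
* [SpringerLAG1998] T. A. Springer, Linear Algebraic Groups, 2nd ed., 2.2.1 (finite index and identity components).
* [CarlsonMullerStachPeters2017] J. Carlson, S. Müller-Stach, C. Peters, Period Mappings and Period Domains, 2nd ed., Lemma–Def. 15.3.7.
-/

noncomputable section

set_option linter.dupNamespace false

namespace Summit.HodgeConjecture.HodgeConjecture.Theorems.Q8SymplecticPowersTransportRestriction

open Module Literature.AlgebraicGeometry.Motives Literature.AlgebraicGeometry.HodgeTheory
open LinearMap (BilinForm)

universe u v

variable {K : Type u} [Field K] {H : Type v} [AddCommGroup H] [Module K H]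

/-! ### §1 `N = Fix(Γ₀)` for one finite-index normal `Γ₀ ≤ Γ` -/

/-- **The finite-orbit span is the fixed space of ONE finite-index normal subgroup.** `H` finite-dimensional, `Γ ≤ GL_K(H)`,
`N := span_K {x | ∃ Γ' ≤ Γ of finite index fixing x}`. Then there is `Γ₀ ≤ Γ`, of finite index and normal in `Γ`, with
`x ∈ N ↔ ∀ γ ∈ Γ₀, γ x = x`. (A finite subset of the generators spans `N`; intersect their stabilisers with `Γ`; take the normal core
in `Γ`.) [cite: SpringerLAG1998, 2.2.1] -/
theorem exists_finiteIndex_normal_span_fixed_iff [Module.Finite K H] (Γ : Subgroup (H ≃ₗ[K] H)) :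
    ∃ Γ₀ : Subgroup (H ≃ₗ[K] H), Γ₀ ≤ Γ ∧ (Γ₀.subgroupOf Γ).FiniteIndex ∧ (Γ₀.subgroupOf Γ).Normal ∧
      ∀ x, x ∈ Submodule.span K {x : H | ∃ Γ' : Subgroup (H ≃ₗ[K] H), Γ' ≤ Γ ∧ (Γ'.subgroupOf Γ).FiniteIndex ∧
        ∀ γ ∈ Γ', γ x = x} ↔ ∀ γ ∈ Γ₀, γ x = x := by
  classical
  set S : Set H := {x : H | ∃ Γ' : Subgroup (H ≃ₗ[K] H), Γ' ≤ Γ ∧ (Γ'.subgroupOf Γ).FiniteIndex ∧ ∀ γ ∈ Γ', γ x = x}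
    with hS
  -- a finite linearly independent spanning subset `b ⊆ S`
  obtain ⟨b, hbS, hspan, hli⟩ := exists_linearIndependent K S
  have hbfin : b.Finite := hli.set_finite_of_isNoetherian
  haveI : Finite b := hbfin.to_subtype
  -- stabilisers of the elements of `b`
  have hstab : ∀ x : b, ∃ Γ' : Subgroup (H ≃ₗ[K] H), Γ' ≤ Γ ∧ (Γ'.subgroupOf Γ).FiniteIndex ∧ ∀ γ ∈ Γ', γ (x : H) = x :=
    fun x => hbS x.2
  choose Γ' hΓ'le hΓ'fi hΓ'fix using hstab
  -- their intersection with `Γ`: `Γ₁` (finite index in `Γ`)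
  set Γ₁ : Subgroup (H ≃ₗ[K] H) := Γ ⊓ ⨅ x : b, Γ' x with hΓ₁
  have hΓ₁le : Γ₁ ≤ Γ := inf_le_left
  have hΓ₁fi : (Γ₁.subgroupOf Γ).FiniteIndex := by
    refine ⟨?_⟩
    change Γ₁.relIndex Γ ≠ 0
    rw [hΓ₁, Subgroup.inf_relIndex_left]
    exact Subgroup.relIndex_iInf_ne_zero fun x => (hΓ'fi x).index_ne_zero
  have hΓ₁fix : ∀ γ ∈ Γ₁, ∀ x : b, γ (x : H) = x := fun γ hγ x =>
    hΓ'fix x γ (Subgroup.mem_iInf.1 (Subgroup.mem_inf.1 hγ).2 x)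
  -- the normal core of `Γ₁` in `Γ`
  set Δ : Subgroup Γ := Γ₁.subgroupOf Γ with hΔ
  haveI : Δ.FiniteIndex := hΓ₁fi
  set Γ₀ : Subgroup (H ≃ₗ[K] H) := Δ.normalCore.map Γ.subtype with hΓ₀
  have hΓ₀Γ : Γ₀.subgroupOf Γ = Δ.normalCore := by
    rw [hΓ₀, Subgroup.subgroupOf, Subgroup.comap_map_eq_self_of_injective (Subgroup.subtype_injective Γ)]
  have hΓ₀le : Γ₀ ≤ Γ := Subgroup.map_subtype_le _
  have hΓ₀Γ₁ : Γ₀ ≤ Γ₁ := by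
    intro γ hγ
    obtain ⟨δ, hδ, rfl⟩ := Subgroup.mem_map.1 hγ
    exact Subgroup.mem_subgroupOf.1 (Subgroup.normalCore_le Δ hδ)
  refine ⟨Γ₀, hΓ₀le, by rw [hΓ₀Γ]; infer_instance, by rw [hΓ₀Γ]; infer_instance, fun x => ⟨fun hx γ hγ => ?_, fun hx => ?_⟩⟩
  · -- `γ ∈ Γ₀ ≤ Γ₁` fixes `b`, hence `span b = span S ∋ x`
    have hγ₁ : γ ∈ Γ₁ := hΓ₀Γ₁ hγ
    have hle : Submodule.span K b ≤ LinearMap.eqLocus (γ : H →ₗ[K] H) LinearMap.id := by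
      rw [Submodule.span_le]
      intro y hy
      exact hΓ₁fix γ hγ₁ ⟨y, hy⟩
    rw [← hspan] at hx
    exact hle hx
  · -- a vector fixed by the finite-index `Γ₀` is a generator
    refine Submodule.subset_span ⟨Γ₀, hΓ₀le, by rw [hΓ₀Γ]; infer_instance, hx⟩

/-- **`N` is `Γ`-stable** (`Γ₀` being normal in `Γ`: for `γ ∈ Γ₀`, `γ (γ₁ x) = γ₁ ((γ₁⁻¹ γ γ₁) x) = γ₁ x`). [cite: SpringerLAG1998, 2.2.1] -/
theorem span_fixed_map_mem [Module.Finite K H] (Γ : Subgroup (H ≃ₗ[K] H)) {γ₁ : H ≃ₗ[K] H} (hγ₁ : γ₁ ∈ Γ) {x : H}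
    (hx : x ∈ Submodule.span K {x : H | ∃ Γ' : Subgroup (H ≃ₗ[K] H), Γ' ≤ Γ ∧ (Γ'.subgroupOf Γ).FiniteIndex ∧
      ∀ γ ∈ Γ', γ x = x}) :
    γ₁ x ∈ Submodule.span K {x : H | ∃ Γ' : Subgroup (H ≃ₗ[K] H), Γ' ≤ Γ ∧ (Γ'.subgroupOf Γ).FiniteIndex ∧
      ∀ γ ∈ Γ', γ x = x} := by
  obtain ⟨Γ₀, hΓ₀le, hfi, hnorm, hiff⟩ := exists_finiteIndex_normal_span_fixed_iff Γ
  rw [hiff] at hx ⊢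
  intro γ hγ
  -- `γ₁⁻¹ γ γ₁ ∈ Γ₀` by normality in `Γ`
  have hconj : γ₁⁻¹ * γ * γ₁ ∈ Γ₀ := by
    have h := hnorm.conj_mem ⟨γ, hΓ₀le hγ⟩ (Subgroup.mem_subgroupOf.2 hγ) ⟨γ₁, hγ₁⟩⁻¹
    simpa [Subgroup.mem_subgroupOf] using h
  have h1 : (γ₁⁻¹ * γ * γ₁) x = x := hx _ hconj
  have h1' : γ₁.symm (γ (γ₁ x)) = x := h1
  have h2 : γ₁ (γ₁.symm (γ (γ₁ x))) = γ₁ x := by rw [h1']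
  rwa [LinearEquiv.apply_symm_apply] at h2

/-- **`N` is stable under every endomorphism commuting with `Γ`** (e.g. the fibrewise deck maps `A = τ^*`, `B = j^*`): `f` maps each
generator fixed by `Γ'` to a vector fixed by `Γ'`. [cite: SpringerLAG1998, 2.2.1] -/
theorem span_fixed_map_mem_of_comm (Γ : Subgroup (H ≃ₗ[K] H)) {f : H →ₗ[K] H} (hf : ∀ γ ∈ Γ, ∀ x, γ (f x) = f (γ x)) {x : H}
    (hx : x ∈ Submodule.span K {x : H | ∃ Γ' : Subgroup (H ≃ₗ[K] H), Γ' ≤ Γ ∧ (Γ'.subgroupOf Γ).FiniteIndex ∧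
      ∀ γ ∈ Γ', γ x = x}) :
    f x ∈ Submodule.span K {x : H | ∃ Γ' : Subgroup (H ≃ₗ[K] H), Γ' ≤ Γ ∧ (Γ'.subgroupOf Γ).FiniteIndex ∧
      ∀ γ ∈ Γ', γ x = x} := by
  rw [← Submodule.mem_comap]
  refine (Submodule.span_le.2 ?_) hx
  rintro y ⟨Γ', hΓ'le, hΓ'fi, hΓ'fix⟩
  exact Submodule.subset_span ⟨Γ', hΓ'le, hΓ'fi, fun γ hγ => by rw [hf γ (hΓ'le hγ), hΓ'fix γ hγ]⟩

/-! ### §2 Restriction groups -/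

/-- **The group of restrictions `Γ_W ≤ GL_K(W)` exists** for `W ≤ H` stable under `Γ ≤ GL_K(H)`, in the interface
`η ∈ Γ_W ↔ ∃ θ ∈ Γ, η = θ|_W` of `GlIdentityComponentInvariantSplitting` ∕ `Q8BireflectionGroupDensityAmbient` (the range of the
restriction homomorphism). [cite: SpringerLAG1998, 2.2.1] -/
theorem exists_restrictSubgroup {W : Submodule K H} {Γ : Subgroup (H ≃ₗ[K] H)} (hΓW : ∀ γ ∈ Γ, ∀ x ∈ W, γ x ∈ W) :
    ∃ ΓW : Subgroup (W ≃ₗ[K] W), ∀ η : W ≃ₗ[K] W, η ∈ ΓW ↔ ∃ θ ∈ Γ, ∀ x : W, ((η x : W) : H) = θ x := by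
  classical
  have hΓW₂ : ∀ θ ∈ Γ, ∀ x ∈ W, θ.symm x ∈ W := fun θ hθ x hx => hΓW θ⁻¹ (Γ.inv_mem hθ) x hx
  let res : ∀ θ : Γ, W ≃ₗ[K] W := fun θ =>
    LinearEquiv.ofLinear (((θ : H ≃ₗ[K] H) : H →ₗ[K] H).restrict (hΓW θ θ.2))
      ((((θ : H ≃ₗ[K] H).symm : H ≃ₗ[K] H) : H →ₗ[K] H).restrict (hΓW₂ θ θ.2))
      (LinearMap.ext fun x => Subtype.ext (by simp)) (LinearMap.ext fun x => Subtype.ext (by simp))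
  have hres : ∀ (θ : Γ) (x : W), ((res θ x : W) : H) = (θ : H ≃ₗ[K] H) x := fun θ x => rfl
  let ψ : Γ →* (W ≃ₗ[K] W) :=
    { toFun := res
      map_one' := LinearEquiv.ext fun x => Subtype.ext (by rw [hres]; rfl)
      map_mul' := fun θ θ' => LinearEquiv.ext fun x => Subtype.ext (by
        change ((res (θ * θ') x : W) : H) = ((res θ (res θ' x) : W) : H)
        rw [hres, hres, hres]; rfl) }
  refine ⟨ψ.range, fun η => ⟨fun hη => ?_, fun hη => ?_⟩⟩
  · obtain ⟨θ, rfl⟩ := MonoidHom.mem_range.1 hη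
    exact ⟨θ, θ.2, fun x => hres θ x⟩
  · obtain ⟨θ, hθ, hηθ⟩ := hη
    refine MonoidHom.mem_range.2 ⟨⟨θ, hθ⟩, LinearEquiv.ext fun x => Subtype.ext ?_⟩
    change ((res ⟨θ, hθ⟩ x : W) : H) = ((η x : W) : H)
    rw [hres, hηθ]

/-- **A finite-index `Γ₀ ≤ Γ` restricts to a finite-index `Γ₀_W ≤ Γ_W`** (index bookkeeping along the surjection `Γ → Γ_W`).
[cite: SpringerLAG1998, 2.2.1] -/
theorem le_and_finiteIndex_restrictSubgroup {W : Submodule K H} {Γ Γ₀ : Subgroup (H ≃ₗ[K] H)} (hle : Γ₀ ≤ Γ)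
    (hfi : (Γ₀.subgroupOf Γ).FiniteIndex) (hΓW : ∀ γ ∈ Γ, ∀ x ∈ W, γ x ∈ W) {ΓW ΓW₀ : Subgroup (W ≃ₗ[K] W)}
    (hΓW' : ∀ η : W ≃ₗ[K] W, η ∈ ΓW ↔ ∃ θ ∈ Γ, ∀ x : W, ((η x : W) : H) = θ x)
    (hΓW₀' : ∀ η : W ≃ₗ[K] W, η ∈ ΓW₀ ↔ ∃ θ ∈ Γ₀, ∀ x : W, ((η x : W) : H) = θ x) :
    ΓW₀ ≤ ΓW ∧ (ΓW₀.subgroupOf ΓW).FiniteIndex := by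
  classical
  have hle' : ΓW₀ ≤ ΓW := fun η hη => by
    obtain ⟨θ, hθ, h⟩ := (hΓW₀' η).1 hη
    exact (hΓW' η).2 ⟨θ, hle hθ, h⟩
  refine ⟨hle', ?_⟩
  have hΓW₂ : ∀ θ ∈ Γ, ∀ x ∈ W, θ.symm x ∈ W := fun θ hθ x hx => hΓW θ⁻¹ (Γ.inv_mem hθ) x hx
  let res : ∀ θ : Γ, W ≃ₗ[K] W := fun θ =>
    LinearEquiv.ofLinear (((θ : H ≃ₗ[K] H) : H →ₗ[K] H).restrict (hΓW θ θ.2))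
      ((((θ : H ≃ₗ[K] H).symm : H ≃ₗ[K] H) : H →ₗ[K] H).restrict (hΓW₂ θ θ.2))
      (LinearMap.ext fun x => Subtype.ext (by simp)) (LinearMap.ext fun x => Subtype.ext (by simp))
  have hres : ∀ (θ : Γ) (x : W), ((res θ x : W) : H) = (θ : H ≃ₗ[K] H) x := fun θ x => rfl
  have hresmem : ∀ θ : Γ, res θ ∈ ΓW := fun θ => (hΓW' _).2 ⟨θ, θ.2, fun x => hres θ x⟩
  let ρ : Γ →* ΓW :=
    { toFun := fun θ => ⟨res θ, hresmem θ⟩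
      map_one' := Subtype.ext (LinearEquiv.ext fun x => Subtype.ext (by rw [hres]; rfl))
      map_mul' := fun θ θ' => Subtype.ext (LinearEquiv.ext fun x => Subtype.ext (by
        change ((res (θ * θ') x : W) : H) = ((res θ (res θ' x) : W) : H)
        rw [hres, hres, hres]; rfl)) }
  have hρsurj : Function.Surjective ρ := fun η => by
    obtain ⟨θ, hθ, hηθ⟩ := (hΓW' η).1 η.2
    refine ⟨⟨θ, hθ⟩, Subtype.ext (LinearEquiv.ext fun x => Subtype.ext ?_)⟩
    change ((res ⟨θ, hθ⟩ x : W) : H) = (((η : W ≃ₗ[K] W) x : W) : H)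
    rw [hres, hηθ]
  have hmap : (Γ₀.subgroupOf Γ).map ρ = ΓW₀.subgroupOf ΓW := by
    ext η
    rw [Subgroup.mem_map, Subgroup.mem_subgroupOf, hΓW₀']
    constructor
    · rintro ⟨θ, hθ, rfl⟩
      exact ⟨θ, Subgroup.mem_subgroupOf.1 hθ, fun x => hres θ x⟩
    · rintro ⟨θ, hθ, hηθ⟩
      refine ⟨⟨θ, hle hθ⟩, Subgroup.mem_subgroupOf.2 hθ, Subtype.ext (LinearEquiv.ext fun x => Subtype.ext ?_)⟩
      change ((res ⟨θ, hle hθ⟩ x : W) : H) = (((η : W ≃ₗ[K] W) x : W) : H)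
      rw [hres, hηθ]
  refine ⟨?_⟩
  rw [← hmap]
  exact ne_zero_of_dvd_ne_zero hfi.index_ne_zero (Subgroup.index_map_dvd _ hρsurj)

/-! ### §3 Stability lemmas -/

/-- An isometry `γ` of `Q` whose inverse preserves `N` preserves `Q.orthogonal N`. [folklore] -/
theorem orthogonal_map_mem_of_isometry {Q : BilinForm K H} {N : Submodule K H} {γ : H ≃ₗ[K] H}
    (hγQ : ∀ x y, Q (γ x) (γ y) = Q x y) (hγN : ∀ x ∈ N, γ.symm x ∈ N) {m : H} (hm : m ∈ Q.orthogonal N) :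
    γ m ∈ Q.orthogonal N := by
  rw [LinearMap.BilinForm.mem_orthogonal_iff] at hm ⊢
  intro n hn
  have h : Q (γ.symm n) m = 0 := hm (γ.symm n) (hγN n hn)
  show Q n (γ m) = 0
  calc Q n (γ m) = Q (γ (γ.symm n)) (γ m) := by rw [LinearEquiv.apply_symm_apply]
    _ = Q (γ.symm n) m := hγQ _ _
    _ = 0 := h

/-- A map commuting with `f` preserves every eigenspace of `f`. [folklore] -/
theorem apply_mem_eigenspace_of_comm {f g : Module.End K H} (h : ∀ x, g (f x) = f (g x)) {c : K} {x : H}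
    (hx : x ∈ f.eigenspace c) : g x ∈ f.eigenspace c := by
  rw [Module.End.mem_eigenspace_iff] at hx ⊢
  rw [← h, hx, map_smul]

/-- A linear endomorphism with a two-sided inverse, as a linear automorphism (used for `A = τ^*` with `A⁴ = 1`, inverse `A³`).
[folklore] -/
theorem exists_linearEquiv_of_mul_eq_one {f g : Module.End K H} (hfg : f * g = 1) (hgf : g * f = 1) :
    ∃ e : H ≃ₗ[K] H, (∀ x, e x = f x) ∧ ∀ x, e.symm x = g x :=
  ⟨LinearEquiv.ofLinear f g hfg hgf, fun _ => rfl, fun _ => rfl⟩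

end Summit.HodgeConjecture.HodgeConjecture.Theorems.Q8SymplecticPowersTransportRestriction

end
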